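import Mathlib.Analysis.Calculus.ContDiff.Comp
import Mathlib.Analysis.Calculus.Deriv.Mul
import Mathlib.Analysis.Calculus.Deriv.Add
import Mathlib.Analysis.Calculus.FDeriv.Measurable
import Mathlib.Analysis.Real.Sqrt
import Mathlib.MeasureTheory.Integral.IntervalIntegral.FundThmCalculus
import Mathlib.MeasureTheory.Measure.Lebesgue.EqHaar
import Mathlib.MeasureTheory.Measure.Haar.NormedSpace
import Mathlib.MeasureTheory.Measure.Prod
import Literature.Analysis.FunctionSpaces.PoincareWirtingerConvex
import HarnessLib

/-!
# Agmon's inequality `sup |Φ|² ≲ ‖∇Φ‖₂ ‖D²Φ‖₂` on three-dimensional exterior domains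
# satisfying a cone condition (radial integration from infinity, no extension operator)

(namespace `Literature.Analysis.FunctionSpaces`)

For a smooth function `Φ` on an open set `U` of a three-dimensional real normed space which, at a
point `x ∈ U`, contains the open cone `{x + s z : s > 0, ‖z − n‖ < ½}` around a unit vector `n`
(every exterior of a compact convex body has this property at every point, with `n` an outward
normal of a supporting half-space), and which decays at infinity in the a priori sense
`‖y‖ |Φ(y)| ≤ C₀`, `‖y‖ ‖DΦ(y)‖ ≤ C₀` on `U`, we **prove** the scale-invariant interpolation
inequality

  `μ(B_{1/2}) · Φ(x)² ≤ (18/θ) ∫_U ‖DΦ‖² dμ + (81 θ/2) ∫_U ‖D²Φ‖² dμ` for every `θ > 0`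
  (`mul_sq_le_lintegral_of_cone`), hence
  `Φ(x)² ≤ (54 / μ(B_{1/2})) · (∫_U ‖DΦ‖²)^{1/2} (∫_U ‖D²Φ‖²)^{1/2}` (`sq_le_sqrt_mul_sqrt_of_cone`),

`μ` any additive Haar measure (Lebesgue measure), `B_{1/2}` the ball of radius `½`, `‖DΦ‖`, `‖D²Φ‖`
the operator norms of `fderiv ℝ Φ` and `fderiv ℝ (fderiv ℝ Φ)`. This is Agmon's inequality
`‖u‖²_{L^∞} ≤ c ‖u‖_{H¹} ‖u‖_{H²}` in three dimensions (Agmon, *Lectures on elliptic boundary value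
problems* (1965), §13; Foias–Manley–Rosa–Temam, *Navier–Stokes equations and turbulence* (2001),
Ch. II, (A.29): `|u|_{L^∞} ≤ c ‖u‖^{1/2} |Au|^{1/2}`) in its homogeneous form on an unbounded
domain, where decay at infinity replaces the lower-order terms; it is the `d = 3` case of the
Gagliardo–Nirenberg inequality on asymptotically flat hypersurfaces of Moschidis (Ann. PDE 2 (2016),
arXiv:1509.08489, Lemma 9.10, first display of the proof: `‖f‖_∞ ≲ ‖f‖^{1/2}_{Ḣ¹} ‖f‖^{1/2}_{Ḣ²}`
for `d = 3`), used there (§9.4) and in Dafermos–Rodnianski–Shlapentokh-Rothman (arXiv:1402.7034,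
Cor. 3.1 (30)) to turn energy decay into the pointwise decay rate `τ^{-3/2+δ}` of waves on Kerr;
the application to the Kerr slices is `Literature/Geometry/Lorentzian/KerrSliceAgmon.lean`.

## Proof (ray averaging and the Hardy inequality with the favourable boundary sign)

* `sq_le_lintegral_ray` (one dimension): for `f ∈ C²[0, ∞)` with `|f(s)|, |f'(s)| ≤ K/s` for large
  `s` and every `θ > 0`, `f(0)² ≤ (4/θ) ∫₀^∞ s² f'(s)² ds + 4θ ∫₀^∞ s² f''(s)² ds`. Indeed with
  `P(s) = (1 + 2s/θ) f² + 2θ s f'²` one has `f(0)² = P(0) = P(L) − ∫₀ᴸ P'` and, by three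
  applications of `2ab ≤ a²/λ + λ b²`, `−P' ≤ (4/θ) s² f'² + 4θ s² f''²` pointwise (the terms `f²/θ`
  and `θ f'²` cancel exactly — this is the radial Hardy inequality `∫₀^∞ f² ≤ 4 ∫₀^∞ s² f'²`, whose
  boundary term at `s = 0` has the favourable sign, built into a single primitive), while
  `P(L) = O(1/L)` by the decay.
* `lintegral_ball_lintegral_ray_le` (averaging, dimension three): for measurable `g ≥ 0`,
  `∫_{‖z−n‖<½} ∫₀^∞ s² g(x + s z) ds dz ≤ 2 ∫ g`: the homothety `z ↦ x + s z` has Jacobian `s³`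
  (`Measure.map_addHaar_smul`, through `lintegral_comp_smul` of
  `PoincareWirtingerConvex.lean`), so the left side is `∫ g(y) k(y) dy` with
  `k(y) = ∫ 1_{‖y − x − s n‖ < s/2} ds/s ≤ ∫_{2‖y−x‖/3}^{2‖y−x‖} ds/s ≤ 2` (Tonelli twice).
* Along the ray `s ↦ x + s z` (`½ < ‖z‖ < 3/2`, inside `U` for `s ≥ 0`), `|f'| ≤ (3/2) ‖DΦ‖` and
  `|f''| ≤ (9/4) ‖D²Φ‖`; averaging the one-dimensional inequality over the ball of directions gives
  `mul_sq_le_lintegral_of_cone`, and minimising over `θ` (`le_two_mul_sqrt_mul_sqrt_of_forall`)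
  gives `sq_le_sqrt_mul_sqrt_of_cone`.

No lower-order term and no dependence on the domain appear: the constant is absolute (the inequality
is scale invariant exactly in dimension three). Mathlib has the Gagliardo–Nirenberg–Sobolev
inequality (`MeasureTheory.eLpNorm_le_eLpNorm_fderiv_of_eq`) but no `L^∞` interpolation inequality of
Agmon type. The tree has the whole-space inequality on `ℝ³`
(`Literature.Analysis.FluidPDE.norm_apply_le_agmon`, for `v, ∇v, ∇²v ∈ L²(ℝ³)`, via the Newton
potential); it does not cover the present situation — functions on an exterior domain with only the
decay `O(1/‖y‖)` are not square integrable, and extending them across the boundary costs lower-order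
(collar) terms which are not controlled by `‖∇Φ‖₂‖D²Φ‖₂` —, whence the intrinsic argument below.
Everything below is proved; no named facts.

## References

* S. Agmon, *Lectures on elliptic boundary value problems*, Van Nostrand (1965), §13, Lemma 13.2.
* C. Foias, O. Manley, R. Rosa, R. Temam, *Navier–Stokes equations and turbulence*, CUP (2001),
  Ch. II, App. A, (A.29) (key `FoiasManleyRosaTemam2001`).
* G. Moschidis, *The `r^p`-weighted energy method of Dafermos and Rodnianski in general
  asymptotically flat spacetimes and applications*, Ann. PDE 2 (2016), arXiv:1509.08489, §9.4 and
  Lemma 9.10 (key `Moschidis2016`).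
* M. Dafermos, I. Rodnianski, Y. Shlapentokh-Rothman, Ann. of Math. 183 (2016), arXiv:1402.7034,
  §3.3, Cor. 3.1 (30) (key `DafermosRodnianskiShlapentokhrothman2014`).
-/

noncomputable section

open MeasureTheory Set Filter Metric Module
open scoped ENNReal Topology

namespace Literature.Analysis.FunctionSpaces

/-! ### The one-dimensional inequality along a ray -/

/-- The pointwise algebra behind the ray inequality: with `P = (1 + 2s/θ) f² + 2θ s f'²`,
`−P' ≤ (4/θ) s² f'² + 4θ s² f''²`; indeed the difference is
`θ⁻¹ (f + θ f')² + θ⁻¹ (f + 2 s f')² + θ (f' + 2 s f'')² ≥ 0` (`a = f`, `b = f'`, `c = f''`). [folklore] -/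
theorem neg_deriv_weight_le (a b c s θ : ℝ) (hθ : 0 < θ) :
    -(2 / θ * 1 * (a * a) + (1 + 2 / θ * s) * (b * a + a * b) +
        (2 * θ * 1 * (b * b) + 2 * θ * s * (c * b + b * c))) ≤
      4 / θ * (s ^ 2 * b ^ 2) + 4 * θ * (s ^ 2 * c ^ 2) := by
  have hθ0 : θ ≠ 0 := hθ.ne'
  have key : 4 / θ * (s ^ 2 * b ^ 2) + 4 * θ * (s ^ 2 * c ^ 2) +
      (2 / θ * 1 * (a * a) + (1 + 2 / θ * s) * (b * a + a * b) +
        (2 * θ * 1 * (b * b) + 2 * θ * s * (c * b + b * c))) =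
      θ⁻¹ * (a + θ * b) ^ 2 + θ⁻¹ * (a + 2 * s * b) ^ 2 + θ * (b + 2 * s * c) ^ 2 := by
    field_simp
    ring
  have h1 : 0 ≤ θ⁻¹ * (a + θ * b) ^ 2 := mul_nonneg (inv_nonneg.2 hθ.le) (sq_nonneg _)
  have h2 : 0 ≤ θ⁻¹ * (a + 2 * s * b) ^ 2 := mul_nonneg (inv_nonneg.2 hθ.le) (sq_nonneg _)
  have h3 : 0 ≤ θ * (b + 2 * s * c) ^ 2 := mul_nonneg hθ.le (sq_nonneg _)
  linarith

/-- **The one-dimensional inequality along a ray.** Let `f ∈ C²[0, ∞)` (derivatives `f'`, `f''`,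
with `f''` continuous) satisfy `|f(s)| ≤ K/s` and `|f'(s)| ≤ K/s` for `s ≥ s₀ > 0`. Then for every
`θ > 0`,
`f(0)² ≤ (4/θ) ∫₀^∞ s² f'(s)² ds + 4θ ∫₀^∞ s² f''(s)² ds`
(`ℝ≥0∞`-valued integrals; both sides may be infinite). This packages `f(0)² ≤ 2∫|f f'|`, the Hardy
inequalities `∫₀^∞ f² ≤ 4∫₀^∞ s² f'²`, `∫₀^∞ f'² ≤ 4 ∫₀^∞ s² f''²` (radial integration from infinity;
the boundary terms at `s = 0` have the favourable sign) and `2√(AB) ≤ A/θ + θB`; cf. the first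
display in the proof of Lemma 9.10 of Moschidis, arXiv:1509.08489. [folklore] -/
theorem sq_le_lintegral_ray {f f' f'' : ℝ → ℝ}
    (hf : ∀ s, 0 ≤ s → HasDerivAt f (f' s) s) (hf' : ∀ s, 0 ≤ s → HasDerivAt f' (f'' s) s)
    (hf'' : ContinuousOn f'' (Ici 0)) {K s₀ : ℝ} (hs₀ : 0 < s₀)
    (hdec : ∀ s, s₀ ≤ s → |f s| ≤ K / s ∧ |f' s| ≤ K / s) {θ : ℝ} (hθ : 0 < θ) :
    ENNReal.ofReal (f 0 ^ 2) ≤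
      ENNReal.ofReal (4 / θ) * (∫⁻ s in Ioi (0 : ℝ), ENNReal.ofReal (s ^ 2 * f' s ^ 2)) +
        ENNReal.ofReal (4 * θ) * ∫⁻ s in Ioi (0 : ℝ), ENNReal.ofReal (s ^ 2 * f'' s ^ 2) := by
  have hfc : ContinuousOn f (Ici 0) := fun s hs ↦ (hf s hs).continuousAt.continuousWithinAt
  have hf'c : ContinuousOn f' (Ici 0) := fun s hs ↦ (hf' s hs).continuousAt.continuousWithinAt
  set M : ℝ := K ^ 2 / s₀ + (2 / θ + 2 * θ) * K ^ 2 with hM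
  have hM0 : 0 ≤ M := by positivity
  -- Step 1: the inequality on a finite interval `[0, L]`, `L ≥ s₀`.
  have hfin : ∀ L, s₀ ≤ L →
      f 0 ^ 2 ≤ M / L + 4 / θ * (∫ s in (0 : ℝ)..L, s ^ 2 * f' s ^ 2) +
        4 * θ * ∫ s in (0 : ℝ)..L, s ^ 2 * f'' s ^ 2 := by
    intro L hL
    have hL0 : 0 < L := hs₀.trans_le hL
    have hIcc : uIcc 0 L = Icc 0 L := uIcc_of_le hL0.le
    have cf : ContinuousOn f (Icc 0 L) := hfc.mono Icc_subset_Ici_self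
    have cf' : ContinuousOn f' (Icc 0 L) := hf'c.mono Icc_subset_Ici_self
    have cf'' : ContinuousOn f'' (Icc 0 L) := hf''.mono Icc_subset_Ici_self
    have hii : ∀ g : ℝ → ℝ, ContinuousOn g (Icc 0 L) → IntervalIntegrable g volume 0 L :=
      fun g hg ↦ ContinuousOn.intervalIntegrable (by rwa [hIcc])
    -- the primitive `P(s) = (1 + 2s/θ) f² + 2θ s f'²` and its derivative
    have hderiv : ∀ s ∈ uIcc 0 L, HasDerivAt
        (fun y ↦ (1 + 2 / θ * y) * (f y * f y) + 2 * θ * y * (f' y * f' y))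
        (2 / θ * 1 * (f s * f s) + (1 + 2 / θ * s) * (f' s * f s + f s * f' s) +
          (2 * θ * 1 * (f' s * f' s) + 2 * θ * s * (f'' s * f' s + f' s * f'' s))) s := by
      intro s hs
      rw [hIcc] at hs
      exact ((((hasDerivAt_id' s).const_mul (2 / θ)).const_add 1).mul
        ((hf s hs.1).mul (hf s hs.1))).add
        (((hasDerivAt_id' s).const_mul (2 * θ)).mul ((hf' s hs.1).mul (hf' s hs.1)))
    have hPc : ContinuousOn (fun s ↦ 2 / θ * 1 * (f s * f s) + (1 + 2 / θ * s) * (f' s * f s +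
        f s * f' s) + (2 * θ * 1 * (f' s * f' s) + 2 * θ * s * (f'' s * f' s + f' s * f'' s)))
        (Icc 0 L) := by
      have hid : ContinuousOn (fun s : ℝ ↦ s) (Icc 0 L) := continuousOn_id
      exact ((continuousOn_const.mul (cf.mul cf)).add
        ((continuousOn_const.add (continuousOn_const.mul hid)).mul
          ((cf'.mul cf).add (cf.mul cf')))).add
        ((continuousOn_const.mul (cf'.mul cf')).add
          ((continuousOn_const.mul hid).mul ((cf''.mul cf').add (cf'.mul cf''))))
    have hFTC := intervalIntegral.integral_eq_sub_of_hasDerivAt hderiv (hii _ hPc)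
    -- the right-hand side densities
    have cA : ContinuousOn (fun s : ℝ ↦ s ^ 2 * f' s ^ 2) (Icc 0 L) :=
      (continuousOn_id.pow 2).mul (cf'.pow 2)
    have cB : ContinuousOn (fun s : ℝ ↦ s ^ 2 * f'' s ^ 2) (Icc 0 L) :=
      (continuousOn_id.pow 2).mul (cf''.pow 2)
    -- `−∫ P' ≤ ∫ ((4/θ) s² f'² + 4θ s² f''²)`
    have hmono : ∫ s in (0 : ℝ)..L, -(2 / θ * 1 * (f s * f s) + (1 + 2 / θ * s) * (f' s * f s +
        f s * f' s) + (2 * θ * 1 * (f' s * f' s) + 2 * θ * s * (f'' s * f' s + f' s * f'' s))) ≤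
        ∫ s in (0 : ℝ)..L, (4 / θ * (s ^ 2 * f' s ^ 2) + 4 * θ * (s ^ 2 * f'' s ^ 2)) :=
      intervalIntegral.integral_mono_on hL0.le (hii _ hPc).neg
        (hii _ ((continuousOn_const.mul cA).add (continuousOn_const.mul cB)))
        fun s _ ↦ neg_deriv_weight_le (f s) (f' s) (f'' s) s θ hθ
    rw [intervalIntegral.integral_neg, hFTC, intervalIntegral.integral_add
      ((hii _ cA).const_mul _) ((hii _ cB).const_mul _), intervalIntegral.integral_const_mul,
      intervalIntegral.integral_const_mul] at hmono
    -- the boundary term at `L`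
    obtain ⟨hfL, hf'L⟩ := hdec L hL
    have hKL : 0 ≤ K / L := (abs_nonneg _).trans hfL
    have hfL2 : f L * f L ≤ (K / L) * (K / L) := by
      rw [← abs_mul_abs_self (f L)]
      exact mul_le_mul hfL hfL (abs_nonneg _) hKL
    have hf'L2 : f' L * f' L ≤ (K / L) * (K / L) := by
      rw [← abs_mul_abs_self (f' L)]
      exact mul_le_mul hf'L hf'L (abs_nonneg _) hKL
    have hbdry : (1 + 2 / θ * L) * (f L * f L) + 2 * θ * L * (f' L * f' L) ≤ M / L := by
      have h1 : (1 + 2 / θ * L) * (f L * f L) ≤ (1 + 2 / θ * L) * ((K / L) * (K / L)) :=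
        mul_le_mul_of_nonneg_left hfL2 (by positivity)
      have h2 : 2 * θ * L * (f' L * f' L) ≤ 2 * θ * L * ((K / L) * (K / L)) :=
        mul_le_mul_of_nonneg_left hf'L2 (by positivity)
      have h3 : (1 + 2 / θ * L) * ((K / L) * (K / L)) + 2 * θ * L * ((K / L) * (K / L)) =
          (K ^ 2 / L + (2 / θ + 2 * θ) * K ^ 2) / L := by
        field_simp
        ring
      have h4 : (K ^ 2 / L + (2 / θ + 2 * θ) * K ^ 2) / L ≤ M / L := by
        rw [hM]
        gcongr
      linarith
    have h0 : (1 + 2 / θ * 0) * (f 0 * f 0) + 2 * θ * 0 * (f' 0 * f' 0) = f 0 ^ 2 := by ring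
    linarith
  -- Step 2: pass to `ℝ≥0∞` and let `L → ∞`.
  set A : ℝ≥0∞ := ∫⁻ s in Ioi (0 : ℝ), ENNReal.ofReal (s ^ 2 * f' s ^ 2) with hA
  set B : ℝ≥0∞ := ∫⁻ s in Ioi (0 : ℝ), ENNReal.ofReal (s ^ 2 * f'' s ^ 2) with hB
  have hAL : ∀ L, 0 < L → ENNReal.ofReal (∫ s in (0 : ℝ)..L, s ^ 2 * f' s ^ 2) ≤ A := by
    intro L hL
    have cA : ContinuousOn (fun s : ℝ ↦ s ^ 2 * f' s ^ 2) (Icc 0 L) :=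
      (continuousOn_id.pow 2).mul ((hf'c.mono Icc_subset_Ici_self).pow 2)
    rw [intervalIntegral.integral_of_le hL.le, ofReal_integral_eq_lintegral_ofReal
      ((cA.integrableOn_compact isCompact_Icc).mono_set Ioc_subset_Icc_self)
      (Eventually.of_forall fun s ↦ by positivity)]
    exact lintegral_mono_set Ioc_subset_Ioi_self
  have hBL : ∀ L, 0 < L → ENNReal.ofReal (∫ s in (0 : ℝ)..L, s ^ 2 * f'' s ^ 2) ≤ B := by
    intro L hL
    have cB : ContinuousOn (fun s : ℝ ↦ s ^ 2 * f'' s ^ 2) (Icc 0 L) :=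
      (continuousOn_id.pow 2).mul ((hf''.mono Icc_subset_Ici_self).pow 2)
    rw [intervalIntegral.integral_of_le hL.le, ofReal_integral_eq_lintegral_ofReal
      ((cB.integrableOn_compact isCompact_Icc).mono_set Ioc_subset_Icc_self)
      (Eventually.of_forall fun s ↦ by positivity)]
    exact lintegral_mono_set Ioc_subset_Ioi_self
  have hstep : ∀ L, s₀ ≤ L → ENNReal.ofReal (f 0 ^ 2) ≤
      ENNReal.ofReal (4 / θ) * A + ENNReal.ofReal (4 * θ) * B + ENNReal.ofReal (M / L) := by
    intro L hL
    have hL0 : 0 < L := hs₀.trans_le hL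
    have hA0 : 0 ≤ ∫ s in (0 : ℝ)..L, s ^ 2 * f' s ^ 2 :=
      intervalIntegral.integral_nonneg hL0.le fun s _ ↦ by positivity
    have hB0 : 0 ≤ ∫ s in (0 : ℝ)..L, s ^ 2 * f'' s ^ 2 :=
      intervalIntegral.integral_nonneg hL0.le fun s _ ↦ by positivity
    calc ENNReal.ofReal (f 0 ^ 2)
        ≤ ENNReal.ofReal (M / L + 4 / θ * (∫ s in (0 : ℝ)..L, s ^ 2 * f' s ^ 2) +
            4 * θ * ∫ s in (0 : ℝ)..L, s ^ 2 * f'' s ^ 2) := ENNReal.ofReal_le_ofReal (hfin L hL)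
      _ ≤ ENNReal.ofReal (M / L) + ENNReal.ofReal (4 / θ * ∫ s in (0 : ℝ)..L, s ^ 2 * f' s ^ 2) +
            ENNReal.ofReal (4 * θ * ∫ s in (0 : ℝ)..L, s ^ 2 * f'' s ^ 2) := by
          refine ENNReal.ofReal_add_le.trans ?_
          gcongr
          exact ENNReal.ofReal_add_le
      _ = ENNReal.ofReal (M / L) +
            ENNReal.ofReal (4 / θ) * ENNReal.ofReal (∫ s in (0 : ℝ)..L, s ^ 2 * f' s ^ 2) +
            ENNReal.ofReal (4 * θ) * ENNReal.ofReal (∫ s in (0 : ℝ)..L, s ^ 2 * f'' s ^ 2) := by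
          rw [ENNReal.ofReal_mul (by positivity), ENNReal.ofReal_mul (by positivity)]
      _ ≤ ENNReal.ofReal (M / L) + ENNReal.ofReal (4 / θ) * A + ENNReal.ofReal (4 * θ) * B := by
          gcongr
          · exact hAL L hL0
          · exact hBL L hL0
      _ = _ := by ring
  refine ENNReal.le_of_forall_pos_le_add fun ε hε _ ↦ ?_
  set L : ℝ := max s₀ (M / ε) with hL
  have hLs : s₀ ≤ L := le_max_left _ _
  have hL0 : 0 < L := hs₀.trans_le hLs
  have hML : M / L ≤ ε := by
    rw [div_le_iff₀ hL0]
    have h1 : M / ε ≤ L := le_max_right _ _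
    rw [div_le_iff₀ (by exact_mod_cast hε)] at h1
    linarith
  calc ENNReal.ofReal (f 0 ^ 2)
      ≤ ENNReal.ofReal (4 / θ) * A + ENNReal.ofReal (4 * θ) * B + ENNReal.ofReal (M / L) := hstep L hLs
    _ ≤ ENNReal.ofReal (4 / θ) * A + ENNReal.ofReal (4 * θ) * B + ε := by
        gcongr
        calc ENNReal.ofReal (M / L) ≤ ENNReal.ofReal ε := ENNReal.ofReal_le_ofReal hML
          _ = ε := ENNReal.ofReal_coe_nnreal

/-! ### Averaging over a ball of directions: the Jacobian of the rays in dimension three -/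

section Averaging

variable {E : Type*} [NormedAddCommGroup E] [NormedSpace ℝ E] [MeasurableSpace E] [BorelSpace E]
  [FiniteDimensional ℝ E] (μ : Measure E) [μ.IsAddHaarMeasure]

/-- **The rays through a ball, at parameter `s`.** For `s > 0`,
`∫_{‖z − n‖ < ½} g(x + s z) dμ(z) = |s⁻ⁿ| ∫_{‖y − x − s n‖ < s/2} g(y) dμ(y)`: the homothety
`z ↦ x + s z` maps the ball `B(n, ½)` onto `B(x + s n, s/2)` with Jacobian `sⁿ`
(`lintegral_comp_smul` of `PoincareWirtingerConvex.lean` and translation invariance). [folklore] -/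
theorem setLIntegral_ball_comp_ray_eq (x n : E) {s : ℝ} (hs : 0 < s) (g : E → ℝ≥0∞) :
    ∫⁻ z in ball n (1 / 2 : ℝ), g (x + s • z) ∂μ =
      ENNReal.ofReal |(s ^ finrank ℝ E)⁻¹| * ∫⁻ y, (ball (x + s • n) (s / 2)).indicator g y ∂μ := by
  rw [← lintegral_indicator measurableSet_ball]
  have h1 : ∀ z, (ball n (1 / 2 : ℝ)).indicator (fun z ↦ g (x + s • z)) z =
      (ball (s • n) (s / 2)).indicator (fun v ↦ g (x + v)) (s • z) := by
    intro z
    have hiff : z ∈ ball n (1 / 2 : ℝ) ↔ s • z ∈ ball (s • n) (s / 2) := by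
      rw [mem_ball, mem_ball, dist_eq_norm, dist_eq_norm, ← smul_sub, norm_smul,
        Real.norm_of_nonneg hs.le]
      constructor
      · intro h
        nlinarith
      · intro h
        nlinarith
    by_cases hz : z ∈ ball n (1 / 2 : ℝ)
    · rw [indicator_of_mem hz, indicator_of_mem (hiff.1 hz)]
    · rw [indicator_of_notMem hz, indicator_of_notMem (fun h ↦ hz (hiff.2 h))]
  simp_rw [h1]
  rw [Literature.Analysis.FunctionSpaces.lintegral_comp_smul μ _ hs.ne']
  congr 1
  have h2 : ∀ v, (ball (s • n) (s / 2)).indicator (fun v ↦ g (x + v)) v =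
      (ball (x + s • n) (s / 2)).indicator g (x + v) := by
    intro v
    have hiff : v ∈ ball (s • n) (s / 2) ↔ x + v ∈ ball (x + s • n) (s / 2) := by
      rw [mem_ball, mem_ball, dist_eq_norm, dist_eq_norm, add_sub_add_left_eq_sub]
    by_cases hv : v ∈ ball (s • n) (s / 2)
    · rw [indicator_of_mem hv, indicator_of_mem (hiff.1 hv)]
    · rw [indicator_of_notMem hv, indicator_of_notMem (fun h ↦ hv (hiff.2 h))]
  simp_rw [h2]
  exact lintegral_add_left_eq_self (μ := μ) ((ball (x + s • n) (s / 2)).indicator g) x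

omit [MeasurableSpace E] [BorelSpace E] [FiniteDimensional ℝ E] in
/-- **The kernel of the ray average, pointwise.** If `‖y − (x + s n)‖ < s/2` with `‖n‖ = 1` then
`2‖y − x‖/3 < s < 2‖y − x‖`, so `1/s ≤ 3/(2‖y − x‖)`: the weight `1_{B(x + s n, s/2)}(y)/s` is
dominated by `(3/(2d)) 1_{(2d/3, 2d)}(s)`, `d = ‖y − x‖`. [folklore] -/
theorem indicator_ball_ray_le (x n : E) (hn : ‖n‖ = 1) (y : E) (s : ℝ) :
    (ball (x + s • n) (s / 2)).indicator (fun _ ↦ ENNReal.ofReal s⁻¹) y ≤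
      (Ioo (2 * ‖y - x‖ / 3) (2 * ‖y - x‖)).indicator
        (fun _ ↦ ENNReal.ofReal (3 / (2 * ‖y - x‖))) s := by
  by_cases hy : y ∈ ball (x + s • n) (s / 2)
  · rw [indicator_of_mem hy]
    rw [mem_ball, dist_eq_norm] at hy
    have hs : 0 < s := by linarith [norm_nonneg (y - (x + s • n))]
    have hsn : ‖s • n‖ = s := by rw [norm_smul, hn, mul_one, Real.norm_of_nonneg hs.le]
    have h1 : ‖y - x‖ ≤ ‖y - (x + s • n)‖ + s := by
      calc ‖y - x‖ = ‖(y - (x + s • n)) + s • n‖ := by congr 1; abel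
        _ ≤ ‖y - (x + s • n)‖ + ‖s • n‖ := norm_add_le _ _
        _ = _ := by rw [hsn]
    have h2 : s ≤ ‖y - x‖ + ‖y - (x + s • n)‖ := by
      calc s = ‖s • n‖ := hsn.symm
        _ = ‖(y - x) - (y - (x + s • n))‖ := by congr 1; abel
        _ ≤ ‖y - x‖ + ‖y - (x + s • n)‖ := norm_sub_le _ _
    have hlo : 2 * ‖y - x‖ / 3 < s := by linarith
    have hhi : s < 2 * ‖y - x‖ := by linarith
    have hd : 0 < ‖y - x‖ := by linarith
    rw [indicator_of_mem (mem_Ioo.2 ⟨hlo, hhi⟩)]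
    apply ENNReal.ofReal_le_ofReal
    rw [inv_eq_one_div, div_le_div_iff₀ hs (by positivity)]
    linarith
  · rw [indicator_of_notMem hy]
    exact bot_le

omit [MeasurableSpace E] [BorelSpace E] [FiniteDimensional ℝ E] in
/-- **The kernel of the ray average integrates to at most `2`:**
`∫₀^∞ 1_{B(x + s n, s/2)}(y) ds/s ≤ (3/(2d)) · |(2d/3, 2d)| = 2`, `d = ‖y − x‖`. [folklore] -/
theorem lintegral_indicator_ball_ray_le (x n : E) (hn : ‖n‖ = 1) (y : E) :
    ∫⁻ s in Ioi (0 : ℝ), (ball (x + s • n) (s / 2)).indicator (fun _ ↦ ENNReal.ofReal s⁻¹) y ≤ 2 := by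
  set d : ℝ := ‖y - x‖ with hd
  calc ∫⁻ s in Ioi (0 : ℝ), (ball (x + s • n) (s / 2)).indicator (fun _ ↦ ENNReal.ofReal s⁻¹) y
      ≤ ∫⁻ s in Ioi (0 : ℝ), (Ioo (2 * d / 3) (2 * d)).indicator
          (fun _ ↦ ENNReal.ofReal (3 / (2 * d))) s :=
        lintegral_mono fun s ↦ indicator_ball_ray_le x n hn y s
    _ ≤ ∫⁻ s, (Ioo (2 * d / 3) (2 * d)).indicator (fun _ ↦ ENNReal.ofReal (3 / (2 * d))) s :=
        setLIntegral_le_lintegral _ _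
    _ = ENNReal.ofReal (3 / (2 * d)) * volume (Ioo (2 * d / 3) (2 * d)) :=
        lintegral_indicator_const measurableSet_Ioo _
    _ = ENNReal.ofReal (3 / (2 * d) * (2 * d - 2 * d / 3)) := by
        rw [Real.volume_Ioo, ← ENNReal.ofReal_mul (by positivity)]
    _ ≤ 2 := by
        have h : 3 / (2 * d) * (2 * d - 2 * d / 3) ≤ 2 := by
          rcases eq_or_lt_of_le (norm_nonneg (y - x)) with h0 | h0
          · rw [hd, ← h0]
            norm_num
          · have hd0 : 0 < d := h0
            rw [show 3 / (2 * d) * (2 * d - 2 * d / 3) = 2 by field_simp; ring]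
        calc ENNReal.ofReal (3 / (2 * d) * (2 * d - 2 * d / 3)) ≤ ENNReal.ofReal 2 :=
              ENNReal.ofReal_le_ofReal h
          _ = 2 := ENNReal.ofReal_ofNat 2

/-- **Averaging along the rays through a ball of directions (dimension three).** For a measurable
`g ≥ 0` on a three-dimensional space, a base point `x` and a unit vector `n`,
`∫_{‖z − n‖ < ½} (∫₀^∞ s² g(x + s z) ds) dμ(z) ≤ 2 ∫ g dμ`:
by Tonelli and the homothety formula the left side is `∫ g(y) k(y) dμ(y)` with the kernel
`k(y) = ∫₀^∞ s² · s⁻³ 1_{B(x + s n, s/2)}(y) ds ≤ 2`. The exponent `2 = n − 1` makes the bound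
scale-free exactly for `n = 3`. [folklore] -/
theorem lintegral_ball_lintegral_ray_le (hE : finrank ℝ E = 3) (x n : E) (hn : ‖n‖ = 1)
    {g : E → ℝ≥0∞} (hg : Measurable g) :
    ∫⁻ z in ball n (1 / 2 : ℝ), ∫⁻ s in Ioi (0 : ℝ), ENNReal.ofReal (s ^ 2) * g (x + s • z) ∂volume ∂μ
      ≤ 2 * ∫⁻ y, g y ∂μ := by
  -- measurability of the two-variable integrands
  have hm1 : Measurable (fun p : E × ℝ ↦ ENNReal.ofReal (p.2 ^ 2) * g (x + p.2 • p.1)) := by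
    refine (ENNReal.measurable_ofReal.comp (by fun_prop)).mul (hg.comp ?_)
    exact (show Continuous (fun p : E × ℝ ↦ x + p.2 • p.1) by fun_prop).measurable
  have hm2 : Measurable (fun p : ℝ × E ↦
      ENNReal.ofReal p.1⁻¹ * (ball (x + p.1 • n) (p.1 / 2)).indicator g p.2) := by
    have hset : MeasurableSet {p : ℝ × E | dist p.2 (x + p.1 • n) < p.1 / 2} :=
      (isOpen_lt (by fun_prop) (by fun_prop)).measurableSet
    have heq : (fun p : ℝ × E ↦ (ball (x + p.1 • n) (p.1 / 2)).indicator g p.2) =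
        {p : ℝ × E | dist p.2 (x + p.1 • n) < p.1 / 2}.indicator (fun p ↦ g p.2) := by
      funext p
      by_cases hp : dist p.2 (x + p.1 • n) < p.1 / 2
      · rw [indicator_of_mem (mem_ball.2 hp), indicator_of_mem (by exact hp)]
      · rw [indicator_of_notMem (fun h ↦ hp (mem_ball.1 h)), indicator_of_notMem (by exact hp)]
    refine (ENNReal.measurable_ofReal.comp measurable_fst.inv).mul ?_
    rw [heq]
    exact (hg.comp measurable_snd).indicator hset
  -- the inner integral at fixed `s > 0`
  have hinner : ∀ s ∈ Ioi (0 : ℝ),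
      ∫⁻ z in ball n (1 / 2 : ℝ), ENNReal.ofReal (s ^ 2) * g (x + s • z) ∂μ =
        ∫⁻ y, ENNReal.ofReal s⁻¹ * (ball (x + s • n) (s / 2)).indicator g y ∂μ := by
    intro s hs
    have hs0 : 0 < s := hs
    rw [lintegral_const_mul' _ _ ENNReal.ofReal_ne_top, setLIntegral_ball_comp_ray_eq μ x n hs0 g,
      hE, lintegral_const_mul' _ _ ENNReal.ofReal_ne_top, ← mul_assoc,
      ← ENNReal.ofReal_mul (sq_nonneg _)]
    congr 2
    rw [abs_of_pos (by positivity)]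
    field_simp
  calc ∫⁻ z in ball n (1 / 2 : ℝ), ∫⁻ s in Ioi (0 : ℝ),
        ENNReal.ofReal (s ^ 2) * g (x + s • z) ∂volume ∂μ
      = ∫⁻ s in Ioi (0 : ℝ), ∫⁻ z in ball n (1 / 2 : ℝ),
          ENNReal.ofReal (s ^ 2) * g (x + s • z) ∂μ ∂volume :=
        lintegral_lintegral_swap hm1.aemeasurable
    _ = ∫⁻ s in Ioi (0 : ℝ), ∫⁻ y,
          ENNReal.ofReal s⁻¹ * (ball (x + s • n) (s / 2)).indicator g y ∂μ ∂volume :=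
        setLIntegral_congr_fun measurableSet_Ioi hinner
    _ = ∫⁻ y, ∫⁻ s in Ioi (0 : ℝ),
          ENNReal.ofReal s⁻¹ * (ball (x + s • n) (s / 2)).indicator g y ∂volume ∂μ :=
        lintegral_lintegral_swap hm2.aemeasurable
    _ ≤ ∫⁻ y, g y * 2 ∂μ := by
        refine lintegral_mono fun y ↦ ?_
        have hpt : ∀ s, ENNReal.ofReal s⁻¹ * (ball (x + s • n) (s / 2)).indicator g y =
            g y * (ball (x + s • n) (s / 2)).indicator (fun _ ↦ ENNReal.ofReal s⁻¹) y := by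
          intro s
          by_cases hy : y ∈ ball (x + s • n) (s / 2)
          · rw [indicator_of_mem hy, indicator_of_mem hy, mul_comm]
          · rw [indicator_of_notMem hy, indicator_of_notMem hy, mul_zero, mul_zero]
        simp_rw [hpt]
        calc ∫⁻ s in Ioi (0 : ℝ), g y *
              (ball (x + s • n) (s / 2)).indicator (fun _ ↦ ENNReal.ofReal s⁻¹) y
            ≤ ∫⁻ s in Ioi (0 : ℝ), g y * (Ioo (2 * ‖y - x‖ / 3) (2 * ‖y - x‖)).indicator
                (fun _ ↦ ENNReal.ofReal (3 / (2 * ‖y - x‖))) s :=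
              lintegral_mono fun s ↦ by
                have := indicator_ball_ray_le x n hn y s
                gcongr
          _ = g y * ∫⁻ s in Ioi (0 : ℝ), (Ioo (2 * ‖y - x‖ / 3) (2 * ‖y - x‖)).indicator
                (fun _ ↦ ENNReal.ofReal (3 / (2 * ‖y - x‖))) s :=
              lintegral_const_mul _ (measurable_const.indicator measurableSet_Ioo)
          _ ≤ g y * 2 := by
              gcongr
              calc ∫⁻ s in Ioi (0 : ℝ), (Ioo (2 * ‖y - x‖ / 3) (2 * ‖y - x‖)).indicator
                    (fun _ ↦ ENNReal.ofReal (3 / (2 * ‖y - x‖))) s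
                  ≤ ∫⁻ s, (Ioo (2 * ‖y - x‖ / 3) (2 * ‖y - x‖)).indicator
                      (fun _ ↦ ENNReal.ofReal (3 / (2 * ‖y - x‖))) s :=
                    setLIntegral_le_lintegral _ _
                _ = ENNReal.ofReal (3 / (2 * ‖y - x‖)) *
                      volume (Ioo (2 * ‖y - x‖ / 3) (2 * ‖y - x‖)) :=
                    lintegral_indicator_const measurableSet_Ioo _
                _ = ENNReal.ofReal (3 / (2 * ‖y - x‖) * (2 * ‖y - x‖ - 2 * ‖y - x‖ / 3)) := by
                    rw [Real.volume_Ioo, ← ENNReal.ofReal_mul (by positivity)]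
                _ ≤ 2 := by
                    have h : 3 / (2 * ‖y - x‖) * (2 * ‖y - x‖ - 2 * ‖y - x‖ / 3) ≤ 2 := by
                      rcases eq_or_lt_of_le (norm_nonneg (y - x)) with h0 | h0
                      · rw [← h0]
                        norm_num
                      · rw [show 3 / (2 * ‖y - x‖) * (2 * ‖y - x‖ - 2 * ‖y - x‖ / 3) = 2 by
                          field_simp; ring]
                    calc ENNReal.ofReal (3 / (2 * ‖y - x‖) * (2 * ‖y - x‖ - 2 * ‖y - x‖ / 3))
                        ≤ ENNReal.ofReal 2 := ENNReal.ofReal_le_ofReal h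
                      _ = 2 := ENNReal.ofReal_ofNat 2
    _ = 2 * ∫⁻ y, g y ∂μ := by rw [lintegral_mul_const _ hg, mul_comm]

end Averaging

/-! ### Agmon's inequality under a cone condition -/

section Agmon

variable {E : Type*} [NormedAddCommGroup E] [NormedSpace ℝ E] [MeasurableSpace E] [BorelSpace E]
  [FiniteDimensional ℝ E] (μ : Measure E) [μ.IsAddHaarMeasure]

/-- **Agmon's inequality on a three-dimensional domain with a cone condition, additive form.**
Let `U` be open in a three-dimensional real normed space, `x ∈ U`, `n` a unit vector such that
the cone `{x + s z : s > 0, ‖z − n‖ < ½}` lies in `U`, and `Φ ∈ C²(U)` with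
`‖y‖ |Φ(y)| ≤ C₀`, `‖y‖ ‖DΦ(y)‖ ≤ C₀` on `U`. Then for every `θ > 0`
`μ(B(0, ½)) Φ(x)² ≤ (18/θ) ∫_U ‖DΦ‖² dμ + (81θ/2) ∫_U ‖D²Φ‖² dμ`
(ray inequality `sq_le_lintegral_ray` along `s ↦ x + s z`, where `|f'| ≤ (3/2)‖DΦ‖`,
`|f''| ≤ (9/4)‖D²Φ‖`, averaged over `z ∈ B(n, ½)` with `lintegral_ball_lintegral_ray_le`). Agmon
(1965) §13; Foias–Manley–Rosa–Temam (2001) Ch. II (A.29); Moschidis arXiv:1509.08489 Lemma 9.10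
(`d = 3`). [cite: FoiasManleyRosaTemam2001, Ch. II (A.29)] -/
theorem mul_sq_le_lintegral_of_cone (hE : finrank ℝ E = 3) {U : Set E} (hU : IsOpen U) {x n : E}
    (hx : x ∈ U) (hn : ‖n‖ = 1)
    (hcone : ∀ z ∈ ball n (1 / 2 : ℝ), ∀ s : ℝ, 0 < s → x + s • z ∈ U)
    {Φ : E → ℝ} (hΦ : ContDiffOn ℝ 2 Φ U) {C₀ : ℝ}
    (hdec : ∀ y ∈ U, ‖y‖ * |Φ y| ≤ C₀ ∧ ‖y‖ * ‖fderiv ℝ Φ y‖ ≤ C₀) {θ : ℝ} (hθ : 0 < θ) :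
    μ (ball (0 : E) (1 / 2)) * ENNReal.ofReal (Φ x ^ 2) ≤
      ENNReal.ofReal (18 / θ) * (∫⁻ y in U, ENNReal.ofReal (‖fderiv ℝ Φ y‖ ^ 2) ∂μ) +
        ENNReal.ofReal (81 * θ / 2) *
          ∫⁻ y in U, ENNReal.ofReal (‖fderiv ℝ (fderiv ℝ Φ) y‖ ^ 2) ∂μ := by
  -- the two densities, extended by zero off `U`
  set G₁ : E → ℝ≥0∞ := U.indicator fun y ↦ ENNReal.ofReal (‖fderiv ℝ Φ y‖ ^ 2) with hG₁
  set G₂ : E → ℝ≥0∞ := U.indicator fun y ↦ ENNReal.ofReal (‖fderiv ℝ (fderiv ℝ Φ) y‖ ^ 2)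
    with hG₂
  have hG₁m : Measurable G₁ :=
    (ENNReal.measurable_ofReal.comp ((measurable_fderiv ℝ Φ).norm.pow_const 2)).indicator
      hU.measurableSet
  have hG₂m : Measurable G₂ :=
    (ENNReal.measurable_ofReal.comp
      ((measurable_fderiv ℝ (fderiv ℝ Φ)).norm.pow_const 2)).indicator hU.measurableSet
  have hI₁ : ∫⁻ y, G₁ y ∂μ = ∫⁻ y in U, ENNReal.ofReal (‖fderiv ℝ Φ y‖ ^ 2) ∂μ :=
    lintegral_indicator hU.measurableSet _
  have hI₂ : ∫⁻ y, G₂ y ∂μ = ∫⁻ y in U, ENNReal.ofReal (‖fderiv ℝ (fderiv ℝ Φ) y‖ ^ 2) ∂μ :=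
    lintegral_indicator hU.measurableSet _
  have hC₀ : 0 ≤ C₀ := le_trans (by positivity) (hdec x hx).1
  -- Step A: the ray inequality for each direction `z` in the ball
  have hray : ∀ z ∈ ball n (1 / 2 : ℝ), ENNReal.ofReal (Φ x ^ 2) ≤
      ENNReal.ofReal (9 / θ) * (∫⁻ s in Ioi (0 : ℝ), ENNReal.ofReal (s ^ 2) * G₁ (x + s • z)) +
        ENNReal.ofReal (81 * θ / 4) *
          ∫⁻ s in Ioi (0 : ℝ), ENNReal.ofReal (s ^ 2) * G₂ (x + s • z) := by
    intro z hz
    have hzn : ‖z - n‖ < 1 / 2 := by rwa [mem_ball, dist_eq_norm] at hz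
    have hz1 : ‖z‖ ≤ 3 / 2 := by
      calc ‖z‖ = ‖(z - n) + n‖ := by rw [sub_add_cancel]
        _ ≤ ‖z - n‖ + ‖n‖ := norm_add_le _ _
        _ ≤ 3 / 2 := by rw [hn]; linarith
    have hz2 : 1 / 2 ≤ ‖z‖ := by
      have : ‖n‖ ≤ ‖z‖ + ‖z - n‖ := by
        calc ‖n‖ = ‖z - (z - n)‖ := by rw [sub_sub_cancel]
          _ ≤ ‖z‖ + ‖z - n‖ := norm_sub_le _ _
      rw [hn] at this
      linarith
    -- the ray `s ↦ x + s z` stays in `U` for `s ≥ 0`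
    have hγU : ∀ s : ℝ, 0 ≤ s → x + s • z ∈ U := by
      intro s hs
      rcases hs.eq_or_lt with h | h
      · rw [← h]
        simpa using hx
      · exact hcone z hz s h
    have hγd : ∀ s : ℝ, HasDerivAt (fun t : ℝ ↦ x + t • z) z s := fun s ↦ by
      simpa using ((hasDerivAt_id' s).smul_const z).const_add x
    have hC2 : ∀ s : ℝ, 0 ≤ s → ContDiffAt ℝ 2 Φ (x + s • z) := fun s hs ↦
      hΦ.contDiffAt (hU.mem_nhds (hγU s hs))
    have hD1 : ∀ s : ℝ, 0 ≤ s → ContDiffAt ℝ 1 (fderiv ℝ Φ) (x + s • z) := fun s hs ↦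
      (hC2 s hs).fderiv_right (by norm_num)
    -- the functions `f, f', f''` along the ray
    set f : ℝ → ℝ := fun s ↦ Φ (x + s • z) with hf
    set f' : ℝ → ℝ := fun s ↦ fderiv ℝ Φ (x + s • z) z with hf'
    set f'' : ℝ → ℝ := fun s ↦ fderiv ℝ (fderiv ℝ Φ) (x + s • z) z z with hf''
    have hfd : ∀ s, 0 ≤ s → HasDerivAt f (f' s) s := fun s hs ↦
      ((hC2 s hs).differentiableAt (by norm_num)).hasFDerivAt.comp_hasDerivAt s (hγd s)
    have hf'd : ∀ s, 0 ≤ s → HasDerivAt f' (f'' s) s := by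
      intro s hs
      have h1 : HasDerivAt (fun t : ℝ ↦ fderiv ℝ Φ (x + t • z))
          (fderiv ℝ (fderiv ℝ Φ) (x + s • z) z) s :=
        ((hD1 s hs).differentiableAt (by norm_num)).hasFDerivAt.comp_hasDerivAt s (hγd s)
      have h2 := h1.clm_apply (hasDerivAt_const s z)
      simpa [hf', hf''] using h2
    have hf''c : ContinuousOn f'' (Ici 0) := by
      intro s hs
      have hc : ContinuousAt (fun t : ℝ ↦ fderiv ℝ (fderiv ℝ Φ) (x + t • z)) s :=
        ContinuousAt.comp (f := fun t : ℝ ↦ x + t • z)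
          ((hD1 s hs).continuousAt_fderiv one_ne_zero) (hγd s).continuousAt
      exact ((hc.clm_apply continuousAt_const).clm_apply continuousAt_const).continuousWithinAt
    -- decay along the ray: for `s ≥ 4(‖x‖ + 1)`, `‖x + s z‖ ≥ s/4`
    have hdec' : ∀ s, 4 * (‖x‖ + 1) ≤ s → |f s| ≤ 6 * C₀ / s ∧ |f' s| ≤ 6 * C₀ / s := by
      intro s hs
      have hs0 : 0 < s := by linarith [norm_nonneg x]
      have hsz : ‖s • z‖ = s * ‖z‖ := by rw [norm_smul, Real.norm_of_nonneg hs0.le]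
      have hγn : s / 4 ≤ ‖x + s • z‖ := by
        have h1 : ‖s • z‖ ≤ ‖x + s • z‖ + ‖x‖ := by
          calc ‖s • z‖ = ‖(x + s • z) - x‖ := by rw [add_sub_cancel_left]
            _ ≤ ‖x + s • z‖ + ‖x‖ := norm_sub_le _ _
        nlinarith
      have hγpos : 0 < ‖x + s • z‖ := by linarith
      obtain ⟨hd1, hd2⟩ := hdec (x + s • z) (hγU s hs0.le)
      have hΦle : |Φ (x + s • z)| ≤ C₀ / ‖x + s • z‖ := by
        rw [le_div_iff₀ hγpos, mul_comm]
        exact hd1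
      have hDle : ‖fderiv ℝ Φ (x + s • z)‖ ≤ C₀ / ‖x + s • z‖ := by
        rw [le_div_iff₀ hγpos, mul_comm]
        exact hd2
      have hinv : C₀ / ‖x + s • z‖ ≤ 4 * C₀ / s := by
        rw [div_le_div_iff₀ hγpos hs0]
        nlinarith
      have h46 : 4 * C₀ / s ≤ 6 * C₀ / s := by
        gcongr
        linarith
      refine ⟨(hΦle.trans hinv).trans h46, ?_⟩
      calc |f' s| = ‖fderiv ℝ Φ (x + s • z) z‖ := (Real.norm_eq_abs _).symm
        _ ≤ ‖fderiv ℝ Φ (x + s • z)‖ * ‖z‖ := ContinuousLinearMap.le_opNorm _ _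
        _ ≤ (4 * C₀ / s) * (3 / 2) :=
            mul_le_mul (hDle.trans hinv) hz1 (norm_nonneg _) (by positivity)
        _ = 6 * C₀ / s := by ring
    -- the one-dimensional inequality
    have h1D := sq_le_lintegral_ray hfd hf'd hf''c (by positivity : (0 : ℝ) < 4 * (‖x‖ + 1))
      hdec' hθ
    -- compare the ray densities with `G₁, G₂`
    have hJ1 : (∫⁻ s in Ioi (0 : ℝ), ENNReal.ofReal (s ^ 2 * f' s ^ 2)) ≤
        ENNReal.ofReal (9 / 4) * ∫⁻ s in Ioi (0 : ℝ), ENNReal.ofReal (s ^ 2) * G₁ (x + s • z) := by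
      rw [← lintegral_const_mul' _ _ ENNReal.ofReal_ne_top]
      refine setLIntegral_mono' measurableSet_Ioi fun s hs ↦ ?_
      have hsU : x + s • z ∈ U := hγU s (le_of_lt hs)
      have hG : G₁ (x + s • z) = ENNReal.ofReal (‖fderiv ℝ Φ (x + s • z)‖ ^ 2) := by
        rw [hG₁, indicator_of_mem hsU]
      rw [hG, ← ENNReal.ofReal_mul (sq_nonneg _),
        ← ENNReal.ofReal_mul (p := (9 / 4 : ℝ)) (by norm_num)]
      apply ENNReal.ofReal_le_ofReal
      have hb : |f' s| ≤ ‖fderiv ℝ Φ (x + s • z)‖ * (3 / 2) := by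
        calc |f' s| = ‖fderiv ℝ Φ (x + s • z) z‖ := (Real.norm_eq_abs _).symm
          _ ≤ ‖fderiv ℝ Φ (x + s • z)‖ * ‖z‖ := ContinuousLinearMap.le_opNorm _ _
          _ ≤ ‖fderiv ℝ Φ (x + s • z)‖ * (3 / 2) := by gcongr
      have hsq : f' s ^ 2 ≤ (‖fderiv ℝ Φ (x + s • z)‖ * (3 / 2)) ^ 2 := by
        rw [← sq_abs (f' s)]
        exact pow_le_pow_left₀ (abs_nonneg _) hb 2
      have hs2 : 0 ≤ s ^ 2 := sq_nonneg s
      nlinarith [mul_le_mul_of_nonneg_left hsq hs2]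
    have hJ2 : (∫⁻ s in Ioi (0 : ℝ), ENNReal.ofReal (s ^ 2 * f'' s ^ 2)) ≤
        ENNReal.ofReal (81 / 16) *
          ∫⁻ s in Ioi (0 : ℝ), ENNReal.ofReal (s ^ 2) * G₂ (x + s • z) := by
      rw [← lintegral_const_mul' _ _ ENNReal.ofReal_ne_top]
      refine setLIntegral_mono' measurableSet_Ioi fun s hs ↦ ?_
      have hsU : x + s • z ∈ U := hγU s (le_of_lt hs)
      have hG : G₂ (x + s • z) = ENNReal.ofReal (‖fderiv ℝ (fderiv ℝ Φ) (x + s • z)‖ ^ 2) := by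
        rw [hG₂, indicator_of_mem hsU]
      rw [hG, ← ENNReal.ofReal_mul (sq_nonneg _),
        ← ENNReal.ofReal_mul (p := (81 / 16 : ℝ)) (by norm_num)]
      apply ENNReal.ofReal_le_ofReal
      have hb : |f'' s| ≤ ‖fderiv ℝ (fderiv ℝ Φ) (x + s • z)‖ * (3 / 2) * (3 / 2) := by
        calc |f'' s| = ‖fderiv ℝ (fderiv ℝ Φ) (x + s • z) z z‖ := (Real.norm_eq_abs _).symm
          _ ≤ ‖fderiv ℝ (fderiv ℝ Φ) (x + s • z) z‖ * ‖z‖ := ContinuousLinearMap.le_opNorm _ _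
          _ ≤ ‖fderiv ℝ (fderiv ℝ Φ) (x + s • z)‖ * ‖z‖ * ‖z‖ := by
              gcongr
              exact ContinuousLinearMap.le_opNorm _ _
          _ ≤ ‖fderiv ℝ (fderiv ℝ Φ) (x + s • z)‖ * (3 / 2) * (3 / 2) := by gcongr
      have hsq : f'' s ^ 2 ≤ (‖fderiv ℝ (fderiv ℝ Φ) (x + s • z)‖ * (3 / 2) * (3 / 2)) ^ 2 := by
        rw [← sq_abs (f'' s)]
        exact pow_le_pow_left₀ (abs_nonneg _) hb 2
      have hs2 : 0 ≤ s ^ 2 := sq_nonneg s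
      nlinarith [mul_le_mul_of_nonneg_left hsq hs2]
    have hf0 : f 0 = Φ x := by simp [hf]
    calc ENNReal.ofReal (Φ x ^ 2) = ENNReal.ofReal (f 0 ^ 2) := by rw [hf0]
      _ ≤ _ := h1D
      _ ≤ ENNReal.ofReal (4 / θ) * (ENNReal.ofReal (9 / 4) *
            ∫⁻ s in Ioi (0 : ℝ), ENNReal.ofReal (s ^ 2) * G₁ (x + s • z)) +
          ENNReal.ofReal (4 * θ) * (ENNReal.ofReal (81 / 16) *
            ∫⁻ s in Ioi (0 : ℝ), ENNReal.ofReal (s ^ 2) * G₂ (x + s • z)) := by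
          gcongr
      _ = _ := by
          rw [← mul_assoc, ← mul_assoc, ← ENNReal.ofReal_mul (by positivity),
            ← ENNReal.ofReal_mul (by positivity),
            show 4 / θ * (9 / 4) = 9 / θ by ring,
            show 4 * θ * (81 / 16) = 81 * θ / 4 by ring]
  -- Step B: average over the ball of directions
  have hmeasJ : ∀ {G : E → ℝ≥0∞}, Measurable G →
      Measurable fun z ↦ ∫⁻ s in Ioi (0 : ℝ), ENNReal.ofReal (s ^ 2) * G (x + s • z) := by
    intro G hG
    have hm : Measurable (fun p : E × ℝ ↦ ENNReal.ofReal (p.2 ^ 2) * G (x + p.2 • p.1)) :=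
      (ENNReal.measurable_ofReal.comp (by fun_prop)).mul
        (hG.comp (show Continuous (fun p : E × ℝ ↦ x + p.2 • p.1) by fun_prop).measurable)
    exact hm.lintegral_prod_right'
  have hball : μ (ball n (1 / 2 : ℝ)) = μ (ball (0 : E) (1 / 2)) := Measure.addHaar_ball_center μ n _
  calc μ (ball (0 : E) (1 / 2)) * ENNReal.ofReal (Φ x ^ 2)
      = ∫⁻ _ in ball n (1 / 2 : ℝ), ENNReal.ofReal (Φ x ^ 2) ∂μ := by
        rw [setLIntegral_const, hball, mul_comm]
    _ ≤ ∫⁻ z in ball n (1 / 2 : ℝ), (ENNReal.ofReal (9 / θ) *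
          (∫⁻ s in Ioi (0 : ℝ), ENNReal.ofReal (s ^ 2) * G₁ (x + s • z)) +
          ENNReal.ofReal (81 * θ / 4) *
            ∫⁻ s in Ioi (0 : ℝ), ENNReal.ofReal (s ^ 2) * G₂ (x + s • z)) ∂μ :=
        setLIntegral_mono' measurableSet_ball hray
    _ = ENNReal.ofReal (9 / θ) * (∫⁻ z in ball n (1 / 2 : ℝ),
            ∫⁻ s in Ioi (0 : ℝ), ENNReal.ofReal (s ^ 2) * G₁ (x + s • z) ∂volume ∂μ) +
          ENNReal.ofReal (81 * θ / 4) * ∫⁻ z in ball n (1 / 2 : ℝ),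
            ∫⁻ s in Ioi (0 : ℝ), ENNReal.ofReal (s ^ 2) * G₂ (x + s • z) ∂volume ∂μ := by
        rw [lintegral_add_left ((hmeasJ hG₁m).const_mul _), lintegral_const_mul _ (hmeasJ hG₁m),
          lintegral_const_mul _ (hmeasJ hG₂m)]
    _ ≤ ENNReal.ofReal (9 / θ) * (2 * ∫⁻ y, G₁ y ∂μ) +
          ENNReal.ofReal (81 * θ / 4) * (2 * ∫⁻ y, G₂ y ∂μ) := by
        gcongr
        · exact lintegral_ball_lintegral_ray_le μ hE x n hn hG₁m
        · exact lintegral_ball_lintegral_ray_le μ hE x n hn hG₂m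
    _ = _ := by
        rw [hI₁, hI₂, ← mul_assoc, ← mul_assoc, ← ENNReal.ofReal_ofNat 2,
          ← ENNReal.ofReal_mul (by positivity), ← ENNReal.ofReal_mul (by positivity),
          show 9 / θ * (2 : ℝ) = 18 / θ by ring, show 81 * θ / 4 * (2 : ℝ) = 81 * θ / 2 by ring]

/-- **Minimising `p/θ + θ q` over `θ > 0`.** If `p, q ≥ 0` and `v ≤ p/θ + θ q` for every `θ > 0`,
then `v ≤ 2 √p √q` (for `p, q > 0` take `θ = √p/√q`; if one of them vanishes let `θ → 0` or
`θ → ∞`). [folklore] -/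
theorem le_two_mul_sqrt_mul_sqrt_of_forall {v p q : ℝ} (hp : 0 ≤ p) (hq : 0 ≤ q)
    (h : ∀ θ : ℝ, 0 < θ → v ≤ p / θ + θ * q) : v ≤ 2 * (Real.sqrt p * Real.sqrt q) := by
  rcases hp.eq_or_lt with hp0 | hp0
  · -- `p = 0`: `v ≤ θ q` for all `θ > 0`, so `v ≤ 0`
    rw [← hp0, Real.sqrt_zero, zero_mul, mul_zero]
    by_contra hv
    push Not at hv
    have h1 := h (v / (2 * (q + 1))) (by positivity)
    rw [← hp0, zero_div, zero_add, div_mul_eq_mul_div,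
      le_div_iff₀ (by positivity : (0 : ℝ) < 2 * (q + 1))] at h1
    nlinarith
  rcases hq.eq_or_lt with hq0 | hq0
  · -- `q = 0`: `v ≤ p/θ` for all `θ > 0`, so `v ≤ 0`
    rw [← hq0, Real.sqrt_zero, mul_zero, mul_zero]
    by_contra hv
    push Not at hv
    have h1 := h (2 * p / v) (by positivity)
    rw [← hq0, mul_zero, add_zero, div_div_eq_mul_div,
      le_div_iff₀ (by positivity : (0 : ℝ) < 2 * p)] at h1
    nlinarith
  · have hsp : 0 < Real.sqrt p := Real.sqrt_pos.2 hp0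
    have hsq : 0 < Real.sqrt q := Real.sqrt_pos.2 hq0
    have h1 := h (Real.sqrt p / Real.sqrt q) (by positivity)
    have e1 : p / (Real.sqrt p / Real.sqrt q) = Real.sqrt p * Real.sqrt q := by
      rw [div_div_eq_mul_div, mul_div_right_comm, Real.div_sqrt]
    have e2 : Real.sqrt p / Real.sqrt q * q = Real.sqrt p * Real.sqrt q := by
      rw [div_mul_eq_mul_div, mul_div_assoc, Real.div_sqrt]
    rw [e1, e2] at h1
    linarith

/-- **Agmon's inequality on a three-dimensional domain with a cone condition.** Under the
hypotheses of `mul_sq_le_lintegral_of_cone`, if `I₁ = ∫_U ‖DΦ‖² dμ` and `I₂ = ∫_U ‖D²Φ‖² dμ` are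
finite then
`Φ(x)² ≤ (54 / μ(B(0, ½))) √I₁ √I₂`
— the homogeneous three-dimensional Agmon inequality `‖u‖²_∞ ≤ c ‖∇u‖₂ ‖D²u‖₂` (Agmon (1965)
§13; Foias–Manley–Rosa–Temam (2001) Ch. II (A.29) `|u|_{L^∞} ≤ c ‖u‖^{1/2} |Au|^{1/2}`; Moschidis
arXiv:1509.08489 Lemma 9.10, `d = 3`) on an unbounded domain, with an absolute constant and no
lower-order term. [cite: FoiasManleyRosaTemam2001, Ch. II (A.29)] -/
theorem sq_le_sqrt_mul_sqrt_of_cone (hE : finrank ℝ E = 3) {U : Set E} (hU : IsOpen U) {x n : E}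
    (hx : x ∈ U) (hn : ‖n‖ = 1)
    (hcone : ∀ z ∈ ball n (1 / 2 : ℝ), ∀ s : ℝ, 0 < s → x + s • z ∈ U)
    {Φ : E → ℝ} (hΦ : ContDiffOn ℝ 2 Φ U) {C₀ : ℝ}
    (hdec : ∀ y ∈ U, ‖y‖ * |Φ y| ≤ C₀ ∧ ‖y‖ * ‖fderiv ℝ Φ y‖ ≤ C₀)
    (h₁ : ∫⁻ y in U, ENNReal.ofReal (‖fderiv ℝ Φ y‖ ^ 2) ∂μ < ⊤)
    (h₂ : ∫⁻ y in U, ENNReal.ofReal (‖fderiv ℝ (fderiv ℝ Φ) y‖ ^ 2) ∂μ < ⊤) :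
    Φ x ^ 2 ≤ 54 / (μ (ball (0 : E) (1 / 2))).toReal *
      (Real.sqrt (∫⁻ y in U, ENNReal.ofReal (‖fderiv ℝ Φ y‖ ^ 2) ∂μ).toReal *
        Real.sqrt (∫⁻ y in U, ENNReal.ofReal (‖fderiv ℝ (fderiv ℝ Φ) y‖ ^ 2) ∂μ).toReal) := by
  set V : ℝ≥0∞ := μ (ball (0 : E) (1 / 2)) with hV
  set I₁ : ℝ≥0∞ := ∫⁻ y in U, ENNReal.ofReal (‖fderiv ℝ Φ y‖ ^ 2) ∂μ with hI₁
  set I₂ : ℝ≥0∞ := ∫⁻ y in U, ENNReal.ofReal (‖fderiv ℝ (fderiv ℝ Φ) y‖ ^ 2) ∂μ with hI₂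
  have hV0 : 0 < V := (isOpen_ball.measure_pos μ (nonempty_ball.2 (by norm_num)))
  have hVt : V < ⊤ := measure_ball_lt_top
  have hv : 0 < V.toReal := ENNReal.toReal_pos hV0.ne' hVt.ne
  -- the additive form, in real numbers
  have hadd : ∀ θ : ℝ, 0 < θ →
      V.toReal * Φ x ^ 2 ≤ 18 * I₁.toReal / θ + θ * (81 * I₂.toReal / 2) := by
    intro θ hθ
    have h := mul_sq_le_lintegral_of_cone μ hE hU hx hn hcone hΦ hdec hθ
    have hfin : ENNReal.ofReal (18 / θ) * I₁ + ENNReal.ofReal (81 * θ / 2) * I₂ ≠ ⊤ :=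
      ENNReal.add_ne_top.2 ⟨ENNReal.mul_ne_top ENNReal.ofReal_ne_top h₁.ne,
        ENNReal.mul_ne_top ENNReal.ofReal_ne_top h₂.ne⟩
    have h' := ENNReal.toReal_mono hfin h
    rw [ENNReal.toReal_mul, ENNReal.toReal_ofReal (sq_nonneg _), ENNReal.toReal_add
      (ENNReal.mul_ne_top ENNReal.ofReal_ne_top h₁.ne)
      (ENNReal.mul_ne_top ENNReal.ofReal_ne_top h₂.ne), ENNReal.toReal_mul, ENNReal.toReal_mul,
      ENNReal.toReal_ofReal (by positivity), ENNReal.toReal_ofReal (by positivity)] at h'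
    calc V.toReal * Φ x ^ 2 ≤ 18 / θ * I₁.toReal + 81 * θ / 2 * I₂.toReal := h'
      _ = 18 * I₁.toReal / θ + θ * (81 * I₂.toReal / 2) := by ring
  have hopt := le_two_mul_sqrt_mul_sqrt_of_forall (by positivity) (by positivity) hadd
  have h27 : Real.sqrt (18 * I₁.toReal) * Real.sqrt (81 * I₂.toReal / 2) =
      27 * (Real.sqrt I₁.toReal * Real.sqrt I₂.toReal) := by
    rw [Real.sqrt_mul (by norm_num), show 81 * I₂.toReal / 2 = (81 / 2) * I₂.toReal by ring,
      Real.sqrt_mul (by norm_num)]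
    have h : Real.sqrt 18 * Real.sqrt (81 / 2) = 27 := by
      rw [← Real.sqrt_mul (by norm_num), show (18 : ℝ) * (81 / 2) = 27 ^ 2 by norm_num,
        Real.sqrt_sq (by norm_num)]
    calc Real.sqrt 18 * Real.sqrt I₁.toReal * (Real.sqrt (81 / 2) * Real.sqrt I₂.toReal)
        = (Real.sqrt 18 * Real.sqrt (81 / 2)) * (Real.sqrt I₁.toReal * Real.sqrt I₂.toReal) := by
          ring
      _ = _ := by rw [h]
  rw [h27] at hopt
  rw [div_mul_eq_mul_div, le_div_iff₀ hv]
  linarith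

end Agmon

end Literature.Analysis.FunctionSpaces

end
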